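import Summits.BirchSwinnertonDyer.BirchSwinnertonDyer.Theorems.BiquadraticEisensteinDescentHeegnerTwistCouplingInSupplyQuarticMinusTripleCubeDescent
import Summits.BirchSwinnertonDyer.BirchSwinnertonDyer.Theorems.BiquadraticEisensteinDescentHeegnerTwistCouplingInSupplyQuarticPlusDescent
import HarnessLib

set_option linter.dupNamespace false -- `Summit.BirchSwinnertonDyer.BirchSwinnertonDyer.Theorems.…` (summit = sub)
set_option autoImplicit false

/-!
# Crux `HeegnerTwistCouplingInSupply` (stmt-BirchSwinnertonDyer-21381) — the QUARTIC `j = 1728` corner `X_p : y² = x³ + p·x` at `p ≡ 3 (mod 16)`: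
# `S(0, r²t²p) = {1, p}` and `S(0, −4r²t²p) = {1, −p}` for primes `r ≡ 1`, `t ≡ 7 (mod 8)` with `(r/p) = −1`, `(t/p) = +1`

Route `BiquadraticEisensteinDescent` (cell `pub/bsd-wall`, width seat `bsd-wall-cm-bed-w4` g14; `--supports` 21381, helper). The curve `X_p : y² = x³ + p·x`
(`j = 1728`, CM by `ℤ[i]`, `p` inert and bad of Kodaira type III) has odd `2`-Selmer parity for `p ≡ 3 (mod 16)` as well as for `p ≡ 15 (mod 16)`;
the latter class is covered for every `p` (`…QuarticCornerAllP`), the former had NO corner theorem (bed-w4 g13 memo §5 (a): «needs a `(7,·)` pin»).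
Numerically (crux memo QUARTIC-TRIPLE-w4g14.md §2) the two-prime twist by `d = −rt` with

  `r ≡ 1 (mod 8)`, `(r/p) = −1`;   `t ≡ 7 (mod 8)`, `(t/p) = +1`

(`d ≡ 1 (mod 8)`, `(d/p) = +1`: `ℚ(√d)` is Heegner for `N(X_p)`) is SHARP in 1031/1031 cases, both values of `(r/t)` — a LEGENDRE-ONLY law. This file
proves it: ★ `mem_selmer_pos_iff_plusThree` (`S(0, r²t²p) = {1, p}`: `d < 0` at `∞`, `r`-multiples by the generic kill of `…QuarticMinusTripleDescent`
with `−b₀ = −t²p` a non-residue mod `r`, the classes `t`, `tp` at `2` modulo `16`) and ★ `mem_selmer_neg_iff_plusThree` (`S(0, −4r²t²p) = {1, −p}`: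
`t`- and `r`-multiples by the generic kill (`−b₀ = 4□p`, `(p/t) = (p/r) = −1`), then `−1, p, 2, −2p` at `p` (`(−1/p) = (2/p) = −1`) and `−2, 2p`
at `t` (`(−2/t) = −1`, `(2p/t) = −1`)). Hypotheses in residue form: `p` a non-residue mod `r` and mod `t`.

HONEST FRAMING: a typed sub-corner on one CM family (measure zero in «all CM `W`»); the crux (residual C⁺) is untouched; BSD is not proved by any
of this. THEOREMS ONLY (no `def`, no named fact, no `sorry`). Supports stmt-BirchSwinnertonDyer-21381.
-/

noncomputable section

open scoped Classical

namespace Summit.BirchSwinnertonDyer.BirchSwinnertonDyer.Theorems.BiquadraticEisensteinDescentHeegnerTwistCouplingInSupplyQuarticPlusThreeDescent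

open Literature.NumberTheory.EllipticCurves Literature.NumberTheory.EllipticCurves.XCubeAddPX
  Summit.BirchSwinnertonDyer.BirchSwinnertonDyer.Theorems.BiquadraticEisensteinDescentHeegnerTwistCouplingInSupplyQuarticTwistLocal
  Summit.BirchSwinnertonDyer.BirchSwinnertonDyer.Theorems.BiquadraticEisensteinDescentHeegnerTwistCouplingInSupplyQuarticTwistDescent
  Summit.BirchSwinnertonDyer.BirchSwinnertonDyer.Theorems.BiquadraticEisensteinDescentHeegnerTwistCouplingInSupplyQuarticMinusTripleDescent
  Summit.BirchSwinnertonDyer.BirchSwinnertonDyer.Theorems.BiquadraticEisensteinDescentHeegnerTwistCouplingInSupplyQuarticMinusTripleCubeDescent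
  Summit.BirchSwinnertonDyer.BirchSwinnertonDyer.Theorems.BiquadraticEisensteinDescentHeegnerTwistCouplingInSupplyQuarticPlusDescent

variable {p r t : ℕ} [hp : Fact p.Prime] [hr : Fact r.Prime] [ht : Fact t.Prime]

/-! ## §1 Residues -/

omit hr ht in
/-- Mod `p ≡ 3 (mod 8)`: `−1`, `2`, `−m²`, `2m²` (`p ∤ m`) are non-residues. [folklore] -/
theorem nonresidues_mod_p_plusThree (hp8 : p % 8 = 3) {m : ℕ} (hm : ¬ p ∣ m) :
    ¬ IsSquare (((-1 : ℤ)) : ZMod p) ∧ ¬ IsSquare (((2 : ℤ)) : ZMod p) ∧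
      ¬ IsSquare (((-((m : ℤ) ^ 2) : ℤ)) : ZMod p) ∧ ¬ IsSquare (((2 * (m : ℤ) ^ 2 : ℤ)) : ZMod p) := by
  have hm1 := not_isSquare_neg_one (p := p) (by omega)
  have h2 : ¬ IsSquare (((2 : ℤ)) : ZMod p) := by
    push_cast
    rw [ZMod.exists_sq_eq_two_iff (by rintro rfl; omega)]
    omega
  have hm0 : ((m : ℤ) : ZMod p) ≠ 0 := natCast_ne_zero_of_not_dvd hm
  refine ⟨hm1, h2, ?_, ?_⟩
  · rw [show (((-((m : ℤ) ^ 2) : ℤ)) : ZMod p) = (((-1 : ℤ)) : ZMod p) * (((m : ℤ) : ZMod p) * ((m : ℤ) : ZMod p)) by push_cast; ring]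
    exact not_isSquare_mul_sq hm1 hm0
  · rw [show (((2 * (m : ℤ) ^ 2 : ℤ)) : ZMod p) = (((2 : ℤ)) : ZMod p) * (((m : ℤ) : ZMod p) * ((m : ℤ) : ZMod p)) by push_cast; ring]
    exact not_isSquare_mul_sq h2 hm0

omit hp hr in
/-- Mod `t ≡ 7 (mod 8)` with `p` a non-residue: `−2`, `2r²p`, `2p`, `−2r²` are non-residues (`(2/t) = +1`, `(−1/t) = −1`; `t ∤ r`). [folklore] -/
theorem nonresidues_mod_t_plusThree (ht8 : t % 8 = 7) (hpt : ¬ IsSquare ((p : ℤ) : ZMod t)) (hr0 : ((r : ℤ) : ZMod t) ≠ 0) :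
    ¬ IsSquare (((-2 : ℤ)) : ZMod t) ∧ ¬ IsSquare (((2 * r ^ 2 * p : ℤ)) : ZMod t) ∧
      ¬ IsSquare (((2 * p : ℤ)) : ZMod t) ∧ ¬ IsSquare (((-(2 * r ^ 2) : ℤ)) : ZMod t) := by
  have hm1 := not_isSquare_neg_one (p := t) (by omega)
  obtain ⟨w, hw⟩ := isSquare_two (p := t) ht8
  have hw0 : w ≠ 0 := by
    rintro rfl
    have h2 : ((2 : ℤ) : ZMod t) = 0 := by rw [hw, mul_zero]
    have : (t : ℤ) ∣ 2 := (ZMod.intCast_zmod_eq_zero_iff_dvd 2 t).mp h2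
    have h' : t ∣ 2 := by exact_mod_cast this
    have := Nat.le_of_dvd two_pos h'
    omega
  have e2 : (((2 : ℤ)) : ZMod t) = w * w := hw
  refine ⟨?_, ?_, ?_, ?_⟩
  · rw [show (((-2 : ℤ)) : ZMod t) = (((-1 : ℤ)) : ZMod t) * (((2 : ℤ)) : ZMod t) by push_cast; ring, e2]
    exact not_isSquare_mul_sq hm1 hw0
  · rw [show (((2 * r ^ 2 * p : ℤ)) : ZMod t) = ((p : ℤ) : ZMod t) * ((((2 : ℤ)) : ZMod t) * ((r : ℤ) : ZMod t) ^ 2) by push_cast; ring, e2,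
      show w * w * ((r : ℤ) : ZMod t) ^ 2 = (w * ((r : ℤ) : ZMod t)) * (w * ((r : ℤ) : ZMod t)) by ring]
    exact not_isSquare_mul_sq hpt (mul_ne_zero hw0 hr0)
  · rw [show (((2 * p : ℤ)) : ZMod t) = ((p : ℤ) : ZMod t) * (((2 : ℤ)) : ZMod t) by push_cast; ring, e2]
    exact not_isSquare_mul_sq hpt hw0
  · rw [show (((-(2 * r ^ 2) : ℤ)) : ZMod t) = (((-1 : ℤ)) : ZMod t) * ((((2 : ℤ)) : ZMod t) * ((r : ℤ) : ZMod t) ^ 2) by push_cast; ring, e2,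
      show w * w * ((r : ℤ) : ZMod t) ^ 2 = (w * ((r : ℤ) : ZMod t)) * (w * ((r : ℤ) : ZMod t)) by ring]
    exact not_isSquare_mul_sq hm1 (mul_ne_zero hw0 hr0)

omit hp ht in
/-- Strips at `r ≡ 1 (mod 4)` with `p` a non-residue: `−t²p = p·(it)²` and `4t²p = p·(2t)²` are non-residues mod `r` (`i² = −1`; `r ∤ 2t`). [folklore] -/
theorem strips_mod_r_plusThree (hr4 : r % 4 = 1) (hpr : ¬ IsSquare ((p : ℤ) : ZMod r)) (ht0 : ((t : ℤ) : ZMod r) ≠ 0)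
    (h20 : ((2 : ℤ) : ZMod r) ≠ 0) :
    ¬ IsSquare (((-(t ^ 2 * p) : ℤ)) : ZMod r) ∧ ¬ IsSquare (((-(-(4 * t ^ 2 * p)) : ℤ)) : ZMod r) := by
  obtain ⟨i, hi⟩ := (ZMod.exists_sq_eq_neg_one_iff (p := r)).mpr (by omega)
  have hi0 : i ≠ 0 := by rintro rfl; simp at hi
  refine ⟨?_, ?_⟩
  · have e : (((-(t ^ 2 * p) : ℤ)) : ZMod r) = ((p : ℤ) : ZMod r) * ((i * ((t : ℤ) : ZMod r)) * (i * ((t : ℤ) : ZMod r))) := by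
      push_cast
      linear_combination ((t : ZMod r) ^ 2 * (p : ZMod r)) * hi
    rw [e]
    exact not_isSquare_mul_sq hpr (mul_ne_zero hi0 ht0)
  · rw [show (((-(-(4 * t ^ 2 * p)) : ℤ)) : ZMod r) =
        ((p : ℤ) : ZMod r) * (((((2 : ℤ)) : ZMod r) * ((t : ℤ) : ZMod r)) * ((((2 : ℤ)) : ZMod r) * ((t : ℤ) : ZMod r))) by push_cast; ring]
    exact not_isSquare_mul_sq hpr (mul_ne_zero h20 ht0)

omit hp hr in
/-- Strip at `t` on the `φ̂`-side: `4r²p = p·(2r)²` is a non-residue mod `t` when `p` is (`t ∤ 2r`). [folklore] -/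
theorem strip_mod_t_plusThree (hpt : ¬ IsSquare ((p : ℤ) : ZMod t)) (hr0 : ((r : ℤ) : ZMod t) ≠ 0) (h20 : ((2 : ℤ) : ZMod t) ≠ 0) :
    ¬ IsSquare (((-(-(4 * r ^ 2 * p)) : ℤ)) : ZMod t) := by
  rw [show (((-(-(4 * r ^ 2 * p)) : ℤ)) : ZMod t) =
      ((p : ℤ) : ZMod t) * (((((2 : ℤ)) : ZMod t) * ((r : ℤ) : ZMod t)) * ((((2 : ℤ)) : ZMod t) * ((r : ℤ) : ZMod t))) by push_cast; ring]
  exact not_isSquare_mul_sq hpt (mul_ne_zero h20 hr0)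

/-! ## §2 The side `S(0, r²t²p) = {1, p}` -/

omit hp hr ht in
/-- **The two `2`-adic kills** (`p ≡ 3 (mod 16)`, `t ≡ 7 (mod 8)`, `r ≡ 1 (mod 8)`; no solutions modulo `16` in either chart): the classes
`t` and `tp` of `S(0, r²t²p)`. [cite: SilvermanAEC2009, proof of Prop. X.6.2(b) («no solutions modulo 16»)] -/
theorem two_adic_kills_plusThree (hp16 : p % 16 = 3) (ht8 : t % 8 = 7) (hr8 : r % 8 = 1) :
    ¬ ((twoIsogenyQuartic 0 (t : ℤ) (r ^ 2 * t * p)).map (Int.castRingHom ℚ_[2])).IsSoluble ∧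
    ¬ ((twoIsogenyQuartic 0 ((t : ℤ) * p) (r ^ 2 * t)).map (Int.castRingHom ℚ_[2])).IsSoluble := by
  have h16 : (2 ^ 4 : ℕ) = 16 := by norm_num
  have hp' : (p : ZMod (2 ^ 4)) = 3 := by
    rw [h16, ← ZMod.natCast_mod p 16, hp16]; rfl
  have hr' : (r : ZMod (2 ^ 4)) = 1 ∨ (r : ZMod (2 ^ 4)) = 9 := by
    have h : r % 16 = 1 ∨ r % 16 = 9 := by omega
    rw [h16, ← ZMod.natCast_mod r 16]
    rcases h with h | h <;> rw [h]
    · exact Or.inl rfl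
    · exact Or.inr rfl
  have ht' : (t : ZMod (2 ^ 4)) = 7 ∨ (t : ZMod (2 ^ 4)) = 15 := by
    have h : t % 16 = 7 ∨ t % 16 = 15 := by omega
    rw [h16, ← ZMod.natCast_mod t 16]
    rcases h with h | h <;> rw [h]
    · exact Or.inl rfl
    · exact Or.inr rfl
  refine ⟨not_isSoluble_two_of_zmod16 ?_, not_isSoluble_two_of_zmod16 ?_⟩ <;>
  · push_cast
    rw [hp']
    rcases hr' with hr1 | hr1 <;> rcases ht' with ht1 | ht1 <;> rw [hr1, ht1] <;> decide

/-- ★ **`S(0, r²t²p) = {1, p}`** for primes `p ≡ 3 (mod 16)`, `r ≡ 1 (mod 8)`, `t ≡ 7 (mod 8)` with `p` a non-residue mod `r` and mod `t`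
(`(r/p) = −1`, `(t/p) = +1`): descent on the divisors of `b = r²t²p` for the twist `X_p^{(−rt)} : y² = x³ + r²t²p·x`. Legendre-only.
[cite: SilvermanAEC2009, Prop. X.4.9 and Prop. X.6.1] -/
theorem mem_selmer_pos_iff_plusThree (hp16 : p % 16 = 3) (hr8 : r % 8 = 1) (ht8 : t % 8 = 7)
    (hpr : ¬ IsSquare ((p : ℤ) : ZMod r)) (hpt : ¬ IsSquare ((p : ℤ) : ZMod t)) (d : ℤ) :
    d ∈ twoIsogenySelmerGroup 0 (r ^ 2 * t ^ 2 * p : ℤ) ↔ d = 1 ∨ d = (p : ℤ) := by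
  have hP := hp.out
  have hR := hr.out
  have hT := ht.out
  have hrp : r ≠ p := by rintro rfl; omega
  have htp : t ≠ p := by rintro rfl; omega
  have hrt : r ≠ t := by rintro rfl; omega
  have hp0 : (p : ℤ) ≠ 0 := by exact_mod_cast hP.ne_zero
  have hr0 : (r : ℤ) ≠ 0 := by exact_mod_cast hR.ne_zero
  have ht0 : (t : ℤ) ≠ 0 := by exact_mod_cast hT.ne_zero
  have hbpos : (0 : ℤ) < r ^ 2 * t ^ 2 * p := by positivity
  have hb : (r ^ 2 * t ^ 2 * p : ℤ) ≠ 0 := hbpos.ne'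
  have cast_ne : ∀ {a m : ℕ}, m.Prime → a.Prime → m ≠ a → ((a : ℤ) : ZMod m) ≠ 0 := fun {a m} hmP haP hma h0 =>
    hma ((Nat.prime_dvd_prime_iff_eq hmP haP).mp (by exact_mod_cast (ZMod.intCast_zmod_eq_zero_iff_dvd a m).mp h0))
  have h2r : ((2 : ℤ) : ZMod r) ≠ 0 := by exact_mod_cast cast_ne (a := 2) hR Nat.prime_two (by rintro rfl; omega)
  obtain ⟨strip_r, -⟩ := strips_mod_r_plusThree (p := p) (t := t) (by omega) hpr (cast_ne hR hT hrt) h2r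
  haveI : Fact (Nat.Prime 2) := ⟨Nat.prime_two⟩
  obtain ⟨k1, k2⟩ := two_adic_kills_plusThree (p := p) (t := t) (r := r) hp16 ht8 hr8
  constructor
  · intro hd
    have hsqf := squarefree_of_mem_twoIsogenySelmerGroup hd
    have hd0 : d ≠ 0 := hsqf.ne_zero
    have hdvd : d ∣ (r ^ 2 * t ^ 2 * p : ℤ) := dvd_of_mem_twoIsogenySelmerGroup hd
    have key : ∀ d' : ℤ, d * d' = (r ^ 2 * t ^ 2 * p : ℤ) → (twoIsogenyQuartic 0 d d').IsLocallySoluble :=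
      fun d' hdd => isLocallySoluble_of_mem hd0 hdd hd
    rcases lt_or_gt_of_ne hd0 with hneg | hpos
    · exfalso
      obtain ⟨d', hd'⟩ := hdvd
      have hd'neg : d' < 0 := by
        rcases pos_and_pos_or_neg_and_neg_of_mul_pos (show 0 < d * d' by rw [← hd']; exact hbpos) with ⟨h1, -⟩ | ⟨-, h2⟩
        · exact absurd h1 (not_lt.mpr hneg.le)
        · exact h2
      exact not_isSoluble_real_twoIsogenyQuartic_of_neg hneg hd'neg le_rfl (key d' hd'.symm).1
    have hrd : ¬ (r : ℤ) ∣ d := fun h =>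
      not_mem_selmer_of_prime_dvd (t := r) (b₀ := (t ^ 2 * p : ℤ)) (by ring) strip_r h hd
    -- remaining positive classes prime to `r`: `1, t, p, tp`
    have hdabs : d = (d.natAbs : ℤ) := (Int.natAbs_of_nonneg hpos.le).symm ▸ rfl
    have hcases : d.natAbs = 1 ∨ d.natAbs = t ∨ d.natAbs = p ∨ d.natAbs = t * p := by
      set m := d.natAbs with hm_def
      have hmsq : Squarefree m := Int.squarefree_natAbs.mpr hsqf
      have hrm : ¬ r ∣ m := fun h => hrd (Int.natCast_dvd.mpr h)
      have hm1 : m ∣ r ^ 2 * t ^ 2 * p := by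
        have h1 := Int.natAbs_dvd_natAbs.mpr hdvd
        have h2 : (r ^ 2 * t ^ 2 * p : ℤ).natAbs = r ^ 2 * t ^ 2 * p := by
          rw [show (r ^ 2 * t ^ 2 * p : ℤ) = ((r ^ 2 * t ^ 2 * p : ℕ) : ℤ) by push_cast; ring, Int.natAbs_natCast]
        rwa [h2] at h1
      have hm2 : m ∣ (r * (t * p)) ^ 2 := dvd_trans hm1 ⟨p, by ring⟩
      have hm3 : m ∣ r * (t * p) := (hmsq.dvd_pow_iff_dvd two_ne_zero).mp hm2
      obtain ⟨a, b, ha, hb, hm⟩ := exists_dvd_and_dvd_of_dvd_mul hm3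
      obtain ⟨b₁, b₂, hb₁, hb₂, rfl⟩ := exists_dvd_and_dvd_of_dvd_mul hb
      have ha1 : a = 1 := by
        rcases (Nat.dvd_prime hR).mp ha with h | h
        · exact h
        · exact absurd ⟨b₁ * b₂, by rw [hm, h]⟩ hrm
      rw [hm, ha1, one_mul]
      rcases (Nat.dvd_prime hT).mp hb₁ with h1 | h1 <;> rcases (Nat.dvd_prime hP).mp hb₂ with h2 | h2 <;> simp [h1, h2]
    rcases hcases with h | h | h | h <;> rw [h] at hdabs <;> push_cast at hdabs <;> subst hdabs
    · exact Or.inl rfl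
    · -- d = t : dies at 2
      exact absurd ((key (r ^ 2 * t * p) (by ring)).2 2) k1
    · exact Or.inr rfl
    · -- d = tp : dies at 2
      exact absurd ((key (r ^ 2 * t) (by ring)).2 2) k2
  · rintro (rfl | rfl)
    · exact one_mem_twoIsogenySelmerGroup 0 hb
    · refine mem_twoIsogenySelmerGroup_of_isSquare hb ?_ ⟨r ^ 2 * t ^ 2, by ring⟩ ⟨r * t, ?_⟩
      · exact Int.squarefree_natAbs.mp (by rw [Int.natAbs_natCast]; exact hP.prime.squarefree)
      · rw [show (r ^ 2 * t ^ 2 * p : ℤ) = (p : ℤ) * (r ^ 2 * t ^ 2) by ring, Int.mul_ediv_cancel_left _ hp0]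
        ring

/-! ## §3 The side `S(0, −4r²t²p) = {1, −p}` -/

/-- ★ **`S(0, −4r²t²p) = {1, −p}`** for primes `p ≡ 3 (mod 16)`, `r ≡ 1 (mod 8)`, `t ≡ 7 (mod 8)` with `p` a non-residue mod `r` and mod `t`:
descent on the divisors of `b′ = −4r²t²p` (Silverman's `S^{(φ)}(E/ℚ)` for `E : y² = x³ + r²t²p·x`). Legendre-only, no `2`-adic analysis.
[cite: SilvermanAEC2009, Prop. X.4.9 and Prop. X.6.1] -/
theorem mem_selmer_neg_iff_plusThree (hp16 : p % 16 = 3) (hr8 : r % 8 = 1) (ht8 : t % 8 = 7)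
    (hpr : ¬ IsSquare ((p : ℤ) : ZMod r)) (hpt : ¬ IsSquare ((p : ℤ) : ZMod t)) (d : ℤ) :
    d ∈ twoIsogenySelmerGroup 0 (-(4 * r ^ 2 * t ^ 2 * p) : ℤ) ↔ d = 1 ∨ d = -(p : ℤ) := by
  have hP := hp.out
  have hR := hr.out
  have hT := ht.out
  have hrp : r ≠ p := by rintro rfl; omega
  have htp : t ≠ p := by rintro rfl; omega
  have hrt : r ≠ t := by rintro rfl; omega
  have hp0 : (p : ℤ) ≠ 0 := by exact_mod_cast hP.ne_zero
  have hr0 : (r : ℤ) ≠ 0 := by exact_mod_cast hR.ne_zero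
  have ht0 : (t : ℤ) ≠ 0 := by exact_mod_cast hT.ne_zero
  have hb : (-(4 * r ^ 2 * t ^ 2 * p) : ℤ) ≠ 0 :=
    neg_ne_zero.mpr (mul_ne_zero (mul_ne_zero (mul_ne_zero (by norm_num) (pow_ne_zero 2 hr0)) (pow_ne_zero 2 ht0)) hp0)
  have hpI : Prime (p : ℤ) := Nat.prime_iff_prime_int.mp hP
  have cast_ne : ∀ {a m : ℕ}, m.Prime → a.Prime → m ≠ a → ((a : ℤ) : ZMod m) ≠ 0 := fun {a m} hmP haP hma h0 =>
    hma ((Nat.prime_dvd_prime_iff_eq hmP haP).mp (by exact_mod_cast (ZMod.intCast_zmod_eq_zero_iff_dvd a m).mp h0))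
  have h2r : ((2 : ℤ) : ZMod r) ≠ 0 := by exact_mod_cast cast_ne (a := 2) hR Nat.prime_two (by rintro rfl; omega)
  have h2t : ((2 : ℤ) : ZMod t) ≠ 0 := by exact_mod_cast cast_ne (a := 2) hT Nat.prime_two (by rintro rfl; omega)
  obtain ⟨-, strip_r⟩ := strips_mod_r_plusThree (p := p) (t := t) (by omega) hpr (cast_ne hR hT hrt) h2r
  have strip_t := strip_mod_t_plusThree (p := p) (r := r) hpt (cast_ne hT hR (Ne.symm hrt)) h2t
  have hp2rt : ¬ p ∣ 2 * r * t := fun h => by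
    rcases (Nat.Prime.dvd_mul hP).mp h with h | h
    · rcases (Nat.Prime.dvd_mul hP).mp h with h | h
      · have := Nat.le_of_dvd two_pos h; omega
      · exact hrp ((Nat.prime_dvd_prime_iff_eq hP hR).mp h).symm
    · exact htp ((Nat.prime_dvd_prime_iff_eq hP hT).mp h).symm
  have hprt : ¬ p ∣ r * t := fun h => hp2rt (by rw [mul_assoc]; exact h.mul_left 2)
  obtain ⟨hm1, h2, hmsq, -⟩ := nonresidues_mod_p_plusThree (p := p) (by omega) hp2rt
  obtain ⟨-, -, -, h2sq⟩ := nonresidues_mod_p_plusThree (p := p) (by omega) hprt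
  obtain ⟨hn2t, h2r2p, h2p, hn2r2⟩ := nonresidues_mod_t_plusThree (p := p) (r := r) ht8 hpt (cast_ne hT hR (Ne.symm hrt))
  have hnd : ∀ m : ℤ, ¬ (p : ℤ) ∣ m → ¬ (p : ℤ) ^ 2 ∣ (p : ℤ) * m := fun m hm => not_sq_dvd_mul_of_not_dvd hm
  have hpm2 : ¬ (p : ℤ) ∣ (((2 * r * t : ℕ) : ℤ)) ^ 2 := fun h => hp2rt (by exact_mod_cast hpI.dvd_of_dvd_pow h)
  have hpm2' : ¬ (p : ℤ) ∣ (((r * t : ℕ) : ℤ)) ^ 2 := fun h => hprt (by exact_mod_cast hpI.dvd_of_dvd_pow h)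
  haveI : Fact (Nat.Prime 2) := ⟨Nat.prime_two⟩
  constructor
  · intro hd
    have hsqf := squarefree_of_mem_twoIsogenySelmerGroup hd
    have hd0 : d ≠ 0 := hsqf.ne_zero
    have hdvd : d ∣ (4 * r ^ 2 * t ^ 2 * p : ℤ) := dvd_neg.mp (dvd_of_mem_twoIsogenySelmerGroup hd)
    have key : ∀ d' : ℤ, d * d' = (-(4 * r ^ 2 * t ^ 2 * p) : ℤ) → (twoIsogenyQuartic 0 d d').IsLocallySoluble :=
      fun d' hdd => isLocallySoluble_of_mem hd0 hdd hd
    have htd : ¬ (t : ℤ) ∣ d := fun h =>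
      not_mem_selmer_of_prime_dvd (t := t) (b₀ := (-(4 * r ^ 2 * p) : ℤ)) (by ring) strip_t h hd
    have hrd : ¬ (r : ℤ) ∣ d := fun h =>
      not_mem_selmer_of_prime_dvd (t := r) (b₀ := (-(4 * t ^ 2 * p) : ℤ)) (by ring) strip_r h hd
    have hcases : d.natAbs = 1 ∨ d.natAbs = 2 ∨ d.natAbs = p ∨ d.natAbs = 2 * p := by
      set m := d.natAbs with hm_def
      have hmsq : Squarefree m := Int.squarefree_natAbs.mpr hsqf
      have hrm : ¬ r ∣ m := fun h => hrd (Int.natCast_dvd.mpr h)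
      have htm : ¬ t ∣ m := fun h => htd (Int.natCast_dvd.mpr h)
      have hm1 : m ∣ 4 * r ^ 2 * t ^ 2 * p := by
        have h1 := Int.natAbs_dvd_natAbs.mpr hdvd
        have h2 : (4 * r ^ 2 * t ^ 2 * p : ℤ).natAbs = 4 * r ^ 2 * t ^ 2 * p := by
          rw [show (4 * r ^ 2 * t ^ 2 * p : ℤ) = ((4 * r ^ 2 * t ^ 2 * p : ℕ) : ℤ) by push_cast; ring, Int.natAbs_natCast]
        rwa [h2] at h1
      have hm2 : m ∣ (r * (t * (2 * p))) ^ 2 := dvd_trans hm1 ⟨p, by ring⟩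
      have hm3 : m ∣ r * (t * (2 * p)) := (hmsq.dvd_pow_iff_dvd two_ne_zero).mp hm2
      obtain ⟨a, b, ha, hb, hm⟩ := exists_dvd_and_dvd_of_dvd_mul hm3
      obtain ⟨b₁, b₂, hb₁, hb₂, rfl⟩ := exists_dvd_and_dvd_of_dvd_mul hb
      obtain ⟨c₁, c₂, hc₁, hc₂, rfl⟩ := exists_dvd_and_dvd_of_dvd_mul hb₂
      have ha1 : a = 1 := by
        rcases (Nat.dvd_prime hR).mp ha with h | h
        · exact h
        · exact absurd ⟨b₁ * (c₁ * c₂), by rw [hm, h]⟩ hrm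
      have hb1 : b₁ = 1 := by
        rcases (Nat.dvd_prime hT).mp hb₁ with h | h
        · exact h
        · exact absurd ⟨a * (c₁ * c₂), by rw [hm, h]; ring⟩ htm
      rw [hm, ha1, hb1, one_mul, one_mul]
      rcases (Nat.dvd_prime Nat.prime_two).mp hc₁ with h1 | h1 <;> rcases (Nat.dvd_prime hP).mp hc₂ with h2 | h2 <;> simp [h1, h2]
    rcases hcases with h | h | h | h <;> rcases Int.natAbs_eq d with hd' | hd' <;> rw [h] at hd' <;> push_cast at hd' <;> subst hd'
    · exact Or.inl rfl
    · -- d = -1 : dies at p (`p ∥ c′`, `−1` a non-residue)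
      refine absurd ((key (4 * r ^ 2 * t ^ 2 * p) (by ring)).2 p) ?_
      have e : (4 * r ^ 2 * t ^ 2 * p : ℤ) = (p : ℤ) * (((2 * r * t : ℕ) : ℤ)) ^ 2 := by push_cast; ring
      rw [e]
      exact not_isSoluble_padic_of_dvd_right (c := -1) (c' := (p : ℤ) * (((2 * r * t : ℕ) : ℤ)) ^ 2) ⟨_, rfl⟩ (hnd _ hpm2) hm1
    · -- d = 2 : dies at p (`2` a non-residue mod `p ≡ 3 (8)`)
      refine absurd ((key (-(2 * r ^ 2 * t ^ 2 * p)) (by ring)).2 p) ?_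
      have e : (-(2 * r ^ 2 * t ^ 2 * p) : ℤ) = (p : ℤ) * (-(2 * (((r * t : ℕ) : ℤ)) ^ 2)) := by push_cast; ring
      rw [e]
      refine not_isSoluble_padic_of_dvd_right (c := 2) (c' := (p : ℤ) * (-(2 * (((r * t : ℕ) : ℤ)) ^ 2))) ⟨_, rfl⟩ (hnd _ ?_) h2
      rw [dvd_neg]
      intro h
      rcases hpI.dvd_or_dvd h with h | h
      · have : (p : ℤ) ≤ 2 := Int.le_of_dvd two_pos h
        have := hP.two_le
        omega
      · exact hpm2' h
    · -- d = -2 : dies at t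
      refine absurd ((key (2 * r ^ 2 * t ^ 2 * p) (by ring)).2 t) ?_
      exact not_isSoluble_padic_of_sq_mul (ℓ := t) (c := -2) (c' := 2 * r ^ 2 * t ^ 2 * p) (c'' := 2 * r ^ 2 * p) (by ring) hn2t h2r2p
    · -- d = p : dies at p (`p ∥ c`, `c′ = −(2rt)²`)
      refine absurd ((key (-(4 * r ^ 2 * t ^ 2)) (by ring)).2 p) ?_
      have e : (-(4 * r ^ 2 * t ^ 2) : ℤ) = -((((2 * r * t : ℕ) : ℤ)) ^ 2) := by push_cast; ring
      rw [e]
      exact not_isSoluble_padic_of_dvd_left (c := (p : ℤ)) (c' := -((((2 * r * t : ℕ) : ℤ)) ^ 2)) (dvd_refl _)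
        (by simpa using hnd 1 (fun h => hP.one_lt.ne' (by exact_mod_cast Int.eq_one_of_dvd_one (by positivity) h))) hmsq
    · exact Or.inr rfl
    · -- d = 2p : dies at t
      refine absurd ((key (-(2 * r ^ 2 * t ^ 2)) (by ring)).2 t) ?_
      exact not_isSoluble_padic_of_sq_mul (ℓ := t) (c := 2 * (p : ℤ)) (c' := -(2 * r ^ 2 * t ^ 2)) (c'' := -(2 * r ^ 2)) (by ring) h2p hn2r2
    · -- d = -2p : dies at p (`p ∥ c`, `c′ = 2(rt)²`)
      refine absurd ((key (2 * r ^ 2 * t ^ 2) (by ring)).2 p) ?_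
      have e : (2 * r ^ 2 * t ^ 2 : ℤ) = 2 * ((((r * t : ℕ) : ℤ)) ^ 2) := by push_cast; ring
      rw [e]
      refine not_isSoluble_padic_of_dvd_left (c := -(2 * (p : ℤ))) (c' := 2 * ((((r * t : ℕ) : ℤ)) ^ 2)) ⟨-2, by ring⟩
        (by
          rw [show (-(2 * (p : ℤ))) = p * (-2) by ring]
          refine hnd _ ?_
          rw [dvd_neg]
          intro h
          have : (p : ℤ) ≤ 2 := Int.le_of_dvd two_pos h
          have := hP.two_le
          omega) h2sq
  · rintro (rfl | rfl)
    · exact one_mem_twoIsogenySelmerGroup 0 hb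
    · refine mem_twoIsogenySelmerGroup_of_isSquare hb ?_ ⟨4 * r ^ 2 * t ^ 2, by ring⟩ ⟨2 * r * t, ?_⟩
      · exact Int.squarefree_natAbs.mp (by rw [Int.natAbs_neg, Int.natAbs_natCast]; exact hP.prime.squarefree)
      · rw [show (-(4 * r ^ 2 * t ^ 2 * p) : ℤ) = -(p : ℤ) * (4 * r ^ 2 * t ^ 2) by ring, Int.mul_ediv_cancel_left _ (neg_ne_zero.mpr hp0)]
        ring

end Summit.BirchSwinnertonDyer.BirchSwinnertonDyer.Theorems.BiquadraticEisensteinDescentHeegnerTwistCouplingInSupplyQuarticPlusThreeDescent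

end
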